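import Literature.NumberTheory.Automorphic.UnitaryGroupDirectSum
import Literature.NumberTheory.Automorphic.UnitaryGroupFormTransport
import Literature.NumberTheory.Automorphic.UnitaryGroupIsotropicLineElements
import HarnessLib

/-!
# The frame embedding `x ↦ B·(x ⊕ y)` of an orthogonal direct sum: isometry and intertwining

[Kudla1984, §1] (the see-saw `U(W₁) × U(W₂) ⊂ U(W₁ ⊕ W₂)` of an orthogonal direct sum);
[BergeronMillsonMoeglin2016Balls] Part 2 §3.1 (the embedding `V⋆ = W^⊥ ↪ V` carrying a special cycle).
Generic algebra over a commutative ring `S` with a ring endomorphism `σ`, for the tree's `Fin`-indexed direct sum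
`J₁ ⊕ᶠ J₂ = finSum N₁ N₂ J₁ J₂` (★ `UnitaryGroupDirectSum`) and change of frame `formCongr σ B H = ᵗσ(B)·H·B`
(★ `UnitaryGroupFormTransport`): given a frame `B ∈ GL_{N₁+N₂}(S)` with

  `hB : ᵗσ(B)·(a • H)·B = J₁ ⊕ᶠ J₂`,

the coordinate embedding `(x, y) ↦ B·(x ⊕ y)` (`Fin.append x y` in the concatenated basis) satisfies

* §1 `finSum_mulVec_append`, `hermForm_finSum_append`: `(J₁ ⊕ᶠ J₂)(x ⊕ y) = J₁x ⊕ J₂y` and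
  `⟨x ⊕ y, x' ⊕ y'⟩_{J₁ ⊕ᶠ J₂} = ⟨x,x'⟩_{J₁} + ⟨y,y'⟩_{J₂}`;
* §2 **isometry** `mul_hermForm_frameEmb_eq` : `a · ⟨B(x ⊕ y), B(x' ⊕ y')⟩_H = ⟨x,x'⟩_{J₁} + ⟨y,y'⟩_{J₂}`, in particular
  `a · ⟨B(x ⊕ 0), B(x' ⊕ 0)⟩_H = ⟨x,x'⟩_{J₁}` (`mul_hermForm_frameEmb_zero_eq`), and injectivity of `x ↦ B(x ⊕ 0)`;
* §3 **intertwining** `conj_finSum_mulVec_frameEmb` : `(B·(g₁ ⊕ᶠ g₂)·B⁻¹)·(B(x ⊕ y)) = B(g₁x ⊕ g₂y)` — the conjugate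
  block-diagonal subgroup `B·(U(J₁) × U(J₂))·B⁻¹ ⊆ U(a • H)` (★ `blockDiagFin`, ★ `unitaryGroupOfFormCongr`) acts on the
  image of the embedding through the first factor and fixes it pointwise through the second when `g₁ = 1`;
* §4 `formCongr_map_eq_finSum_map`: the frame equation under a ring homomorphism `τ` with `τ ∘ σ = σ' ∘ τ`;
* §5 complex points (`τ : E →+* ℂ`, `τ ∘ σ = conj ∘ τ`): `τ a · ⟨B^τ z, B^τ z'⟩_{H^τ} = ⟨z₁,z₁'⟩_{J₁^τ} + ⟨z₂,z₂'⟩_{J₂^τ}`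
  for ALL complex `z, z'`, and for `τ a` a positive real `Re ⟨B^τ(z ⊕ 0), B^τ(z ⊕ 0)⟩_{H^τ} < 0 ↔ Re ⟨z,z⟩_{J₁^τ} < 0`
  — the embedding carries the negative cone (disc/ball) of `J₁^τ` into that of `H^τ`.

All proved, [folklore]-level linear algebra; the see-saw / special-cycle context is [Kudla1984, §1] and BMM Part 2
§3.1.  Written for the cell `hodgecm-mathlib` (A-plan2 `GS-PROGRAMME.md` §9 A.11 (G2), «ref2 N2's sanity lemmas
without Shimura objects»; companion of ★ `ShimuraVarieties/UnitaryAnisotropicLineFrame`, which PRODUCES such frames).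
The negative cone itself (`ShimuraVarieties.negCone`, `Re ⟨v,v⟩ < 0`) is not imported here; §5 is stated with
`Re (hermForm (starRingEnd ℂ) …) < 0`, which is `mem_negCone_iff` verbatim on the consumer side.
-/

set_option autoImplicit false

noncomputable section

namespace Literature.NumberTheory.Automorphic.UnitaryGroup

open _root_.Matrix

/-! ## §1 Vectors in the concatenated basis: `(J₁ ⊕ᶠ J₂)(x ⊕ y)` and `⟨x ⊕ y, x' ⊕ y'⟩` -/

section Append

variable {S : Type*} [CommRing S] {N₁ N₂ : ℕ} (J₁ : Matrix (Fin N₁) (Fin N₁) S) (J₂ : Matrix (Fin N₂) (Fin N₂) S)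

/-- `(J₁ ⊕ᶠ J₂)(castAdd i, castAdd j) = J₁ i j`. [cite: Kudla1984, §1] -/
theorem finSum_apply_castAdd_castAdd (i j : Fin N₁) :
    finSum N₁ N₂ J₁ J₂ (Fin.castAdd N₂ i) (Fin.castAdd N₂ j) = J₁ i j := by
  simp [finSum]

/-- `(J₁ ⊕ᶠ J₂)(castAdd i, natAdd j) = 0`: the summands are orthogonal. [cite: Kudla1984, §1] -/
theorem finSum_apply_castAdd_natAdd (i : Fin N₁) (j : Fin N₂) :
    finSum N₁ N₂ J₁ J₂ (Fin.castAdd N₂ i) (Fin.natAdd N₁ j) = 0 := by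
  simp [finSum]

/-- `(J₁ ⊕ᶠ J₂)(natAdd i, castAdd j) = 0`: the summands are orthogonal. [cite: Kudla1984, §1] -/
theorem finSum_apply_natAdd_castAdd (i : Fin N₂) (j : Fin N₁) :
    finSum N₁ N₂ J₁ J₂ (Fin.natAdd N₁ i) (Fin.castAdd N₂ j) = 0 := by
  simp [finSum]

/-- `(J₁ ⊕ᶠ J₂)(natAdd i, natAdd j) = J₂ i j`. [cite: Kudla1984, §1] -/
theorem finSum_apply_natAdd_natAdd (i j : Fin N₂) :
    finSum N₁ N₂ J₁ J₂ (Fin.natAdd N₁ i) (Fin.natAdd N₁ j) = J₂ i j := by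
  simp [finSum]

/-- **`(J₁ ⊕ᶠ J₂)·(x ⊕ y) = J₁x ⊕ J₂y`** in the concatenated basis (`Fin.append`). [cite: Kudla1984, §1] -/
theorem finSum_mulVec_append (x : Fin N₁ → S) (y : Fin N₂ → S) :
    finSum N₁ N₂ J₁ J₂ *ᵥ Fin.append x y = Fin.append (J₁ *ᵥ x) (J₂ *ᵥ y) := by
  funext k
  induction k using Fin.addCases with
  | left i =>
    simp only [Matrix.mulVec, dotProduct, Fin.sum_univ_add, finSum_apply_castAdd_castAdd,
      finSum_apply_castAdd_natAdd, Fin.append_left, Fin.append_right, zero_mul, Finset.sum_const_zero, add_zero]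
  | right j =>
    simp only [Matrix.mulVec, dotProduct, Fin.sum_univ_add, finSum_apply_natAdd_castAdd,
      finSum_apply_natAdd_natAdd, Fin.append_left, Fin.append_right, zero_mul, Finset.sum_const_zero, zero_add]

omit [CommRing S] in
/-- `σ ∘ (x ⊕ y) = (σ ∘ x) ⊕ (σ ∘ y)` (plumbing). [folklore] -/
private theorem comp_append {S' : Type*} (f : S → S') (x : Fin N₁ → S) (y : Fin N₂ → S) :
    f ∘ Fin.append x y = Fin.append (f ∘ x) (f ∘ y) := by
  funext k
  induction k using Fin.addCases with
  | left i => simp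
  | right j => simp

/-- `(x ⊕ y) · (x' ⊕ y') = x·x' + y·y'` for the dot product (plumbing). [folklore] -/
private theorem append_dotProduct_append (x x' : Fin N₁ → S) (y y' : Fin N₂ → S) :
    Fin.append x y ⬝ᵥ Fin.append x' y' = x ⬝ᵥ x' + y ⬝ᵥ y' := by
  simp only [dotProduct, Fin.sum_univ_add, Fin.append_left, Fin.append_right]

/-- **`⟨x ⊕ y, x' ⊕ y'⟩_{J₁ ⊕ᶠ J₂} = ⟨x, x'⟩_{J₁} + ⟨y, y'⟩_{J₂}`**: the direct sum is orthogonal.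
[cite: Kudla1984, §1] -/
theorem hermForm_finSum_append (σ : S →+* S) (x x' : Fin N₁ → S) (y y' : Fin N₂ → S) :
    hermForm σ (finSum N₁ N₂ J₁ J₂) (Fin.append x y) (Fin.append x' y') =
      hermForm σ J₁ x x' + hermForm σ J₂ y y' := by
  rw [hermForm_apply, hermForm_apply, hermForm_apply, finSum_mulVec_append, comp_append, append_dotProduct_append]

end Append

/-! ## §2 The frame embedding is an isometry -/

section Isometry

variable {S : Type*} [CommRing S] (σ : S →+* S) {n : Type*} [Fintype n] [DecidableEq n]

/-- `⟨g v, g w⟩_H = ⟨v, w⟩_{ᵗσ(g)·H·g}`: the pairing in a new frame (the tree's `hermForm_mulVec` at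
`H' := ᵗσ(g)·H·g`). [cite: Dieudonne1971GroupesClassiques, Chap. II §5] -/
theorem hermForm_mulVec_mulVec_eq_hermForm_formCongr (H : Matrix n n S) (g : GL n S) (v w : n → S) :
    hermForm σ H ((g : Matrix n n S) *ᵥ v) ((g : Matrix n n S) *ᵥ w) = hermForm σ (formCongr σ g H) v w := by
  have h1 : (⇑σ ∘ ((g : Matrix n n S) *ᵥ v)) = (g : Matrix n n S).map σ *ᵥ (⇑σ ∘ v) :=
    funext fun i => RingHom.map_mulVec σ (g : Matrix n n S) v i
  rw [hermForm_apply, hermForm_apply, h1]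
  simp only [formCongr]
  calc ((g : Matrix n n S).map σ *ᵥ (⇑σ ∘ v)) ⬝ᵥ (H *ᵥ ((g : Matrix n n S) *ᵥ w))
      = (((⇑σ ∘ v) ᵥ* ((g : Matrix n n S).map σ)ᵀ) ᵥ* H ᵥ* (g : Matrix n n S)) ⬝ᵥ w := by
        rw [Matrix.vecMul_transpose, Matrix.dotProduct_mulVec, Matrix.dotProduct_mulVec]
    _ = ((⇑σ ∘ v) ᵥ* (((g : Matrix n n S).map σ)ᵀ * H * (g : Matrix n n S))) ⬝ᵥ w := by
        rw [Matrix.vecMul_vecMul, Matrix.vecMul_vecMul, Matrix.mul_assoc]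
    _ = (⇑σ ∘ v) ⬝ᵥ ((((g : Matrix n n S).map σ)ᵀ * H * (g : Matrix n n S)) *ᵥ w) := by
        rw [Matrix.dotProduct_mulVec]

omit [DecidableEq n] in
/-- `⟨u, v⟩_{a • H} = a · ⟨u, v⟩_H`. [folklore]-level; [cite: Dieudonne1971GroupesClassiques, Chap. II §5] -/
theorem hermForm_smul_matrix (a : S) (H : Matrix n n S) (u v : n → S) :
    hermForm σ (a • H) u v = a * hermForm σ H u v := by
  rw [hermForm_apply, hermForm_apply, Matrix.smul_mulVec, dotProduct_smul, smul_eq_mul]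

variable {N₁ N₂ : ℕ}

/-- **The frame embedding is an isometry up to the scalar `a`**: if `ᵗσ(B)·(a • H)·B = J₁ ⊕ᶠ J₂` then
`a · ⟨B(x ⊕ y), B(x' ⊕ y')⟩_H = ⟨x, x'⟩_{J₁} + ⟨y, y'⟩_{J₂}`. [cite: Kudla1984, §1]
[cite: BergeronMillsonMoeglin2016Balls, Part 2 §3.1] -/
theorem mul_hermForm_frameEmb_eq {a : S} {H : Matrix (Fin (N₁ + N₂)) (Fin (N₁ + N₂)) S}
    {B : GL (Fin (N₁ + N₂)) S} {J₁ : Matrix (Fin N₁) (Fin N₁) S} {J₂ : Matrix (Fin N₂) (Fin N₂) S}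
    (hB : formCongr σ B (a • H) = finSum N₁ N₂ J₁ J₂) (x x' : Fin N₁ → S) (y y' : Fin N₂ → S) :
    a * hermForm σ H ((B : Matrix (Fin (N₁ + N₂)) (Fin (N₁ + N₂)) S) *ᵥ Fin.append x y) ((B : Matrix (Fin (N₁ + N₂)) (Fin (N₁ + N₂)) S) *ᵥ Fin.append x' y') =
      hermForm σ J₁ x x' + hermForm σ J₂ y y' := by
  rw [← hermForm_smul_matrix, hermForm_mulVec_mulVec_eq_hermForm_formCongr, hB, hermForm_finSum_append]

/-- **The first-summand embedding `x ↦ B(x ⊕ 0)` is an isometry `(Sᴺ¹, J₁) → (Sᴺ¹⁺ᴺ², a • H)`**: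
`a · ⟨B(x ⊕ 0), B(x' ⊕ 0)⟩_H = ⟨x, x'⟩_{J₁}`. [cite: Kudla1984, §1] [cite: BergeronMillsonMoeglin2016Balls, Part 2 §3.1] -/
theorem mul_hermForm_frameEmb_zero_eq {a : S} {H : Matrix (Fin (N₁ + N₂)) (Fin (N₁ + N₂)) S}
    {B : GL (Fin (N₁ + N₂)) S} {J₁ : Matrix (Fin N₁) (Fin N₁) S} {J₂ : Matrix (Fin N₂) (Fin N₂) S}
    (hB : formCongr σ B (a • H) = finSum N₁ N₂ J₁ J₂) (x x' : Fin N₁ → S) :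
    a * hermForm σ H ((B : Matrix (Fin (N₁ + N₂)) (Fin (N₁ + N₂)) S) *ᵥ Fin.append x (0 : Fin N₂ → S)) ((B : Matrix (Fin (N₁ + N₂)) (Fin (N₁ + N₂)) S) *ᵥ Fin.append x' (0 : Fin N₂ → S)) =
      hermForm σ J₁ x x' := by
  rw [mul_hermForm_frameEmb_eq σ hB, hermForm_zero_right, add_zero]

/-- **The second summand is orthogonal to the first under the frame**: `⟨B(x ⊕ 0), B(0 ⊕ y)⟩_H = 0` as soon as
`a` is not a zero divisor (e.g. a unit, or any non-zero element of a domain). [cite: Kudla1984, §1] -/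
theorem hermForm_frameEmb_inl_inr_eq_zero {a : S} (ha : a ∈ nonZeroDivisors S)
    {H : Matrix (Fin (N₁ + N₂)) (Fin (N₁ + N₂)) S}
    {B : GL (Fin (N₁ + N₂)) S} {J₁ : Matrix (Fin N₁) (Fin N₁) S} {J₂ : Matrix (Fin N₂) (Fin N₂) S}
    (hB : formCongr σ B (a • H) = finSum N₁ N₂ J₁ J₂) (x : Fin N₁ → S) (y : Fin N₂ → S) :
    hermForm σ H ((B : Matrix (Fin (N₁ + N₂)) (Fin (N₁ + N₂)) S) *ᵥ Fin.append x (0 : Fin N₂ → S)) ((B : Matrix (Fin (N₁ + N₂)) (Fin (N₁ + N₂)) S) *ᵥ Fin.append (0 : Fin N₁ → S) y) = 0 := by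
  have h := mul_hermForm_frameEmb_eq σ hB x (0 : Fin N₁ → S) (0 : Fin N₂ → S) y
  rw [hermForm_zero_right, hermForm_zero_left, add_zero] at h
  exact (mem_nonZeroDivisors_iff.1 ha).1 _ h

/-- `x ⊕ 0 = x' ⊕ 0 → x = x'` (plumbing). [folklore] -/
private theorem append_zero_injective : Function.Injective fun x : Fin N₁ → S => Fin.append x (0 : Fin N₂ → S) :=
  fun x x' h => funext fun i => by
    have := congrFun h (Fin.castAdd N₂ i)
    simpa only [Fin.append_left] using this

/-- **The frame embedding `x ↦ B(x ⊕ 0)` is injective** (`B` is invertible). [cite: Kudla1984, §1] -/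
theorem frameEmb_injective (B : GL (Fin (N₁ + N₂)) S) :
    Function.Injective fun x : Fin N₁ → S => (B : Matrix (Fin (N₁ + N₂)) (Fin (N₁ + N₂)) S) *ᵥ Fin.append x (0 : Fin N₂ → S) := by
  intro x x' h
  apply append_zero_injective
  have h' := congrArg (fun v => ((B⁻¹ : GL (Fin (N₁ + N₂)) S) : Matrix (Fin (N₁ + N₂)) (Fin (N₁ + N₂)) S) *ᵥ v) h
  simpa only [Matrix.mulVec_mulVec, ← Units.val_mul, inv_mul_cancel, Units.val_one, Matrix.one_mulVec] using h'

end Isometry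

/-! ## §3 The frame embedding intertwines the conjugate block-diagonal subgroup -/

section Intertwine

variable {S : Type*} [CommRing S] {N₁ N₂ : ℕ}

/-- **Intertwining**: `(B·(g₁ ⊕ᶠ g₂)·B⁻¹)·(B(x ⊕ y)) = B(g₁x ⊕ g₂y)` — the conjugate `B·(g₁ ⊕ᶠ g₂)·B⁻¹` of a block
diagonal matrix (the matrix of ★ `blockDiagFin σ J₁ J₂ (g₁, g₂)` is `g₁ ⊕ᶠ g₂ = finSum N₁ N₂ g₁ g₂`, and
★ `unitaryGroupOfFormCongr` is `g ↦ B g B⁻¹`) acts on the frame embedding blockwise. [cite: Kudla1984, §1] -/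
theorem conj_finSum_mulVec_frameEmb (B : GL (Fin (N₁ + N₂)) S) (g₁ : Matrix (Fin N₁) (Fin N₁) S)
    (g₂ : Matrix (Fin N₂) (Fin N₂) S) (x : Fin N₁ → S) (y : Fin N₂ → S) :
    ((B : Matrix (Fin (N₁ + N₂)) (Fin (N₁ + N₂)) S) * finSum N₁ N₂ g₁ g₂ * ((B⁻¹ : GL (Fin (N₁ + N₂)) S) : Matrix (Fin (N₁ + N₂)) (Fin (N₁ + N₂)) S)) *ᵥ
        ((B : Matrix (Fin (N₁ + N₂)) (Fin (N₁ + N₂)) S) *ᵥ Fin.append x y) =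
      (B : Matrix (Fin (N₁ + N₂)) (Fin (N₁ + N₂)) S) *ᵥ Fin.append (g₁ *ᵥ x) (g₂ *ᵥ y) := by
  rw [Matrix.mulVec_mulVec, Matrix.mul_assoc, Matrix.mul_assoc, ← Units.val_mul, inv_mul_cancel, Units.val_one,
    Matrix.mul_one, ← Matrix.mulVec_mulVec, finSum_mulVec_append]

/-- The same for the tree's `blockDiagFin σ J₁ J₂ (g₁, g₂) ∈ U(σ, J₁ ⊕ᶠ J₂)`:
`(B·diag(g₁,g₂)·B⁻¹)·(B(x ⊕ y)) = B(g₁x ⊕ g₂y)`. [cite: Kudla1984, §1] -/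
theorem conj_blockDiagFin_mulVec_frameEmb (σ : S →+* S) (J₁ : Matrix (Fin N₁) (Fin N₁) S)
    (J₂ : Matrix (Fin N₂) (Fin N₂) S) (B : GL (Fin (N₁ + N₂)) S)
    (g : unitaryGroupOfForm σ J₁ × unitaryGroupOfForm σ J₂) (x : Fin N₁ → S) (y : Fin N₂ → S) :
    ((B * ((blockDiagFin σ J₁ J₂ g : unitaryGroupOfForm σ (finSum N₁ N₂ J₁ J₂)) : GL (Fin (N₁ + N₂)) S) * B⁻¹ :
          GL (Fin (N₁ + N₂)) S) : Matrix (Fin (N₁ + N₂)) (Fin (N₁ + N₂)) S) *ᵥ ((B : Matrix (Fin (N₁ + N₂)) (Fin (N₁ + N₂)) S) *ᵥ Fin.append x y) =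
      (B : Matrix (Fin (N₁ + N₂)) (Fin (N₁ + N₂)) S) *ᵥ Fin.append (((g.1 : GL (Fin N₁) S) : Matrix (Fin N₁) (Fin N₁) S) *ᵥ x)
        (((g.2 : GL (Fin N₂) S) : Matrix (Fin N₂) (Fin N₂) S) *ᵥ y) := by
  rw [Units.val_mul, Units.val_mul, coe_blockDiagFin]
  exact conj_finSum_mulVec_frameEmb B _ _ x y

/-- **The second factor fixes the embedded first summand pointwise**: `(B·(1 ⊕ᶠ g₂)·B⁻¹)·(B(x ⊕ 0)) = B(x ⊕ 0)`.
[cite: Kudla1984, §1] -/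
theorem conj_finSum_one_mulVec_frameEmb_zero (B : GL (Fin (N₁ + N₂)) S) (g₂ : Matrix (Fin N₂) (Fin N₂) S)
    (x : Fin N₁ → S) :
    ((B : Matrix (Fin (N₁ + N₂)) (Fin (N₁ + N₂)) S) * finSum N₁ N₂ 1 g₂ * ((B⁻¹ : GL (Fin (N₁ + N₂)) S) : Matrix (Fin (N₁ + N₂)) (Fin (N₁ + N₂)) S)) *ᵥ
        ((B : Matrix (Fin (N₁ + N₂)) (Fin (N₁ + N₂)) S) *ᵥ Fin.append x (0 : Fin N₂ → S)) =
      (B : Matrix (Fin (N₁ + N₂)) (Fin (N₁ + N₂)) S) *ᵥ Fin.append x 0 := by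
  rw [conj_finSum_mulVec_frameEmb, Matrix.one_mulVec, Matrix.mulVec_zero]

/-- **The first factor acts through itself**: `(B·(g₁ ⊕ᶠ 1)·B⁻¹)·(B(x ⊕ 0)) = B(g₁x ⊕ 0)`. [cite: Kudla1984, §1] -/
theorem conj_finSum_one_right_mulVec_frameEmb_zero (B : GL (Fin (N₁ + N₂)) S)
    (g₁ : Matrix (Fin N₁) (Fin N₁) S) (x : Fin N₁ → S) :
    ((B : Matrix (Fin (N₁ + N₂)) (Fin (N₁ + N₂)) S) * finSum N₁ N₂ g₁ 1 * ((B⁻¹ : GL (Fin (N₁ + N₂)) S) : Matrix (Fin (N₁ + N₂)) (Fin (N₁ + N₂)) S)) *ᵥ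
        ((B : Matrix (Fin (N₁ + N₂)) (Fin (N₁ + N₂)) S) *ᵥ Fin.append x (0 : Fin N₂ → S)) =
      (B : Matrix (Fin (N₁ + N₂)) (Fin (N₁ + N₂)) S) *ᵥ Fin.append (g₁ *ᵥ x) (0 : Fin N₂ → S) := by
  rw [conj_finSum_mulVec_frameEmb, Matrix.mulVec_zero]

end Intertwine

/-! ## §4 Change of scalars: the frame equation under a ring homomorphism -/

section MapFrame

variable {S S' : Type*} [CommRing S] [CommRing S'] {N₁ N₂ : ℕ}

/-- **The frame equation is preserved by a ring homomorphism intertwining the involutions**: if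
`τ ∘ σ = σ' ∘ τ` and `ᵗσ(B)·(a • H)·B = J₁ ⊕ᶠ J₂`, then `ᵗσ'(B^τ)·(τ a • H^τ)·B^τ = J₁^τ ⊕ᶠ J₂^τ` (used with
`τ : E →+* ℂ`, `σ'` complex conjugation: the frame on complex points). [cite: Kudla1984, §1]
[cite: BergeronMillsonMoeglin2016Balls, Part 2 §1.1] -/
theorem formCongr_map_eq_finSum_map {σ : S →+* S} {σ' : S' →+* S'} (τ : S →+* S')
    (hτ : ∀ x, τ (σ x) = σ' (τ x)) {a : S} {H : Matrix (Fin (N₁ + N₂)) (Fin (N₁ + N₂)) S}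
    {B : GL (Fin (N₁ + N₂)) S} {J₁ : Matrix (Fin N₁) (Fin N₁) S} {J₂ : Matrix (Fin N₂) (Fin N₂) S}
    (hB : formCongr σ B (a • H) = finSum N₁ N₂ J₁ J₂) :
    formCongr σ' (Matrix.GeneralLinearGroup.map τ B) (τ a • H.map τ) = finSum N₁ N₂ (J₁.map τ) (J₂.map τ) := by
  have hcoe : ((Matrix.GeneralLinearGroup.map τ B : GL (Fin (N₁ + N₂)) S') : Matrix (Fin (N₁ + N₂)) (Fin (N₁ + N₂)) S') =
      (B : Matrix (Fin (N₁ + N₂)) (Fin (N₁ + N₂)) S).map τ := rfl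
  have hστ : ((B : Matrix (Fin (N₁ + N₂)) (Fin (N₁ + N₂)) S).map τ).map σ' = ((B : Matrix (Fin (N₁ + N₂)) (Fin (N₁ + N₂)) S).map σ).map τ := by
    rw [Matrix.map_map, Matrix.map_map]
    exact congrArg _ (funext fun x => (hτ x).symm)
  have h := congrArg (fun M : Matrix (Fin (N₁ + N₂)) (Fin (N₁ + N₂)) S => M.map τ) hB
  simp only [formCongr, Matrix.map_mul, Matrix.transpose_map, finSum_map] at h
  simp only [formCongr, hcoe, hστ]
  rw [← h]
  congr 2
  ext i j
  simp [Matrix.map_apply, smul_eq_mul]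

end MapFrame

/-! ## §5 Complex points: the frame embedding on `τ`-points and the sign of `⟨z, z⟩` -/

section ComplexPoints

variable {E : Type*} [Field E] (σ : E →+* E) (τ : E →+* ℂ) {N₁ N₂ : ℕ}

/-- **The frame embedding on complex points is an isometry up to `τ a`**: for `τ ∘ σ = conj ∘ τ` and
`ᵗσ(B)·(a • H)·B = J₁ ⊕ᶠ J₂`, every pair of COMPLEX vectors `z = z₁ ⊕ z₂`, `z' = z₁' ⊕ z₂'` satisfies
`τ a · ⟨B^τ z, B^τ z'⟩_{H^τ} = ⟨z₁, z₁'⟩_{J₁^τ} + ⟨z₂, z₂'⟩_{J₂^τ}` (not only `τ`-rational ones: the frame equation is a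
matrix identity, ★ `formCongr_map_eq_finSum_map`). [cite: BergeronMillsonMoeglin2016Balls, Part 2 §1.1 and §3.1] -/
theorem mul_hermForm_map_frameEmb_eq (hτ : ∀ x, τ (σ x) = starRingEnd ℂ (τ x)) {a : E}
    {H : Matrix (Fin (N₁ + N₂)) (Fin (N₁ + N₂)) E} {B : GL (Fin (N₁ + N₂)) E} {J₁ : Matrix (Fin N₁) (Fin N₁) E}
    {J₂ : Matrix (Fin N₂) (Fin N₂) E} (hB : formCongr σ B (a • H) = finSum N₁ N₂ J₁ J₂)
    (z₁ z₁' : Fin N₁ → ℂ) (z₂ z₂' : Fin N₂ → ℂ) :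
    τ a * hermForm (starRingEnd ℂ) (H.map τ)
        ((B : Matrix (Fin (N₁ + N₂)) (Fin (N₁ + N₂)) E).map τ *ᵥ Fin.append z₁ z₂)
        ((B : Matrix (Fin (N₁ + N₂)) (Fin (N₁ + N₂)) E).map τ *ᵥ Fin.append z₁' z₂') =
      hermForm (starRingEnd ℂ) (J₁.map τ) z₁ z₁' + hermForm (starRingEnd ℂ) (J₂.map τ) z₂ z₂' :=
  mul_hermForm_frameEmb_eq (starRingEnd ℂ) (formCongr_map_eq_finSum_map τ hτ hB) z₁ z₁' z₂ z₂'

/-- **Sign of `⟨z, z⟩` under the first-summand embedding on complex points**: if moreover `τ a` is a POSITIVE REAL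
(e.g. `a = 1`, or `a` a totally positive element of the real subfield), then `B^τ(z ⊕ 0)` is `H^τ`-negative iff `z`
is `J₁^τ`-negative — the embedding carries the negative cone (ball/disc) of `J₁^τ` into that of `H^τ`
(`Re ⟨B^τ(z ⊕ 0), B^τ(z ⊕ 0)⟩_{H^τ} < 0 ↔ Re ⟨z, z⟩_{J₁^τ} < 0`). [cite: BergeronMillsonMoeglin2016Balls, Part 2 §1.3 and §3.1] -/
theorem re_hermForm_map_frameEmb_self_neg_iff (hτ : ∀ x, τ (σ x) = starRingEnd ℂ (τ x)) {a : E}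
    (ha : 0 < (τ a).re) (ha' : (τ a).im = 0)
    {H : Matrix (Fin (N₁ + N₂)) (Fin (N₁ + N₂)) E} {B : GL (Fin (N₁ + N₂)) E} {J₁ : Matrix (Fin N₁) (Fin N₁) E}
    {J₂ : Matrix (Fin N₂) (Fin N₂) E} (hB : formCongr σ B (a • H) = finSum N₁ N₂ J₁ J₂) (z : Fin N₁ → ℂ) :
    (hermForm (starRingEnd ℂ) (H.map τ)
        ((B : Matrix (Fin (N₁ + N₂)) (Fin (N₁ + N₂)) E).map τ *ᵥ Fin.append z (0 : Fin N₂ → ℂ))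
        ((B : Matrix (Fin (N₁ + N₂)) (Fin (N₁ + N₂)) E).map τ *ᵥ Fin.append z (0 : Fin N₂ → ℂ))).re < 0 ↔
      (hermForm (starRingEnd ℂ) (J₁.map τ) z z).re < 0 := by
  have h := mul_hermForm_map_frameEmb_eq σ τ hτ hB z z (0 : Fin N₂ → ℂ) 0
  rw [hermForm_zero_right, add_zero] at h
  rw [← h, Complex.mul_re, ha', zero_mul, sub_zero]
  constructor
  · intro hq
    exact mul_neg_of_pos_of_neg ha hq
  · intro hq
    by_contra hge
    exact absurd hq (not_lt.2 (mul_nonneg ha.le (not_lt.1 hge)))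

/-- The case `a = 1` (`τ 1 = 1`): `Re ⟨B^τ(z ⊕ 0), B^τ(z ⊕ 0)⟩_{H^τ} < 0 ↔ Re ⟨z, z⟩_{J₁^τ} < 0` for
`ᵗσ(B)·((1 : E) • H)·B = J₁ ⊕ᶠ J₂`. [cite: BergeronMillsonMoeglin2016Balls, Part 2 §1.3 and §3.1] -/
theorem re_hermForm_map_frameEmb_self_neg_iff_one (hτ : ∀ x, τ (σ x) = starRingEnd ℂ (τ x))
    {H : Matrix (Fin (N₁ + N₂)) (Fin (N₁ + N₂)) E} {B : GL (Fin (N₁ + N₂)) E} {J₁ : Matrix (Fin N₁) (Fin N₁) E}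
    {J₂ : Matrix (Fin N₂) (Fin N₂) E} (hB : formCongr σ B ((1 : E) • H) = finSum N₁ N₂ J₁ J₂) (z : Fin N₁ → ℂ) :
    (hermForm (starRingEnd ℂ) (H.map τ)
        ((B : Matrix (Fin (N₁ + N₂)) (Fin (N₁ + N₂)) E).map τ *ᵥ Fin.append z (0 : Fin N₂ → ℂ))
        ((B : Matrix (Fin (N₁ + N₂)) (Fin (N₁ + N₂)) E).map τ *ᵥ Fin.append z (0 : Fin N₂ → ℂ))).re < 0 ↔
      (hermForm (starRingEnd ℂ) (J₁.map τ) z z).re < 0 :=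
  re_hermForm_map_frameEmb_self_neg_iff σ τ hτ (by rw [map_one, Complex.one_re]; exact one_pos)
    (by rw [map_one, Complex.one_im]) hB z

end ComplexPoints

end Literature.NumberTheory.Automorphic.UnitaryGroup

end
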